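import Literature.AnabelianGeometry.EtaleTheta.Discharge.Sec5DivMatchingOfTransport

/-!
# [EtTh] §5, Thm. 5.7 anchor: the SEEDS `αs, βs` and the `e = 1` divisor binders PRODUCED from Thm. 5.10 (i)'s inputs and "Prop. 5.3 (vi) read at `A_1`" (p.329, p.333 / PDF p.103, p.107)

Mochizuki, *The étale theta function …*, Publ. RIMS **45** (2009): proof of Thm. 5.6, p.329 (PDF p.103) "since `Ψ` preserves
pre-steps and Frobenius-trivial objects … `T₁` is Frobenius-trivial, hence isomorphic to `S₁` [cf. our assumption that `S₁^bs ≅ S₂^bs`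
is characteristic; [FrdI], Theorem 5.1, (iii)].  Moreover, since `Ψ` [essentially] preserves the divisor of zeroes and poles of `Θ̈`
[cf. Proposition 5.3, (vi)], it follows [cf. … [FrdI], Definition 1.3, (iii), (d)] that there exist isomorphisms `γ₁ : S₁ ⥲ T₁`,
`γ₂ : S₂ ⥲ T₂` …"; Thm. 5.10 (i), p.333 (PDF p.107) "`Ψ` preserves the isomorphism classes of `A_N`, `B_N`"
[cite: MochizukiEtTh2009, Thm 5.6 proof p.329 (PDF p.103); Thm 5.10 (i) p.333 (PDF p.107)]; [FrdI] Thm. 5.1 (iii), Thm. 5.2 (ii)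
[cite: MochizukiFrdI2008, Thm. 5.2(ii) p.101].

PROOF-ONLY (0 definitions, no new named fact).  abc-iut cell, layer L2, ROWS #14 **R232 sequel** (abc-iut-w5-d245 gen 4), for the
residual list of abc-iut-L2-d4 gen 5's anchored capstone `thetaRootPreservedAll_ofConnectedTemperoidYddFamily_ofAnchored_ofPulledConstants`
(p442166): its items «seeds `αs : Ψ(A_1) ⥲ A_1`, `βs : Ψ(B_1) ⥲ B_1` [Thm. 5.10 (i)]» and «`hdivcap₁`/`hdivcup₁` [Prop. 5.3 (vi) @`A_1`,
`e = 1` form]» are PRODUCED TOGETHER (`exists_seeds_div_eq_refl_model`, model case; `exists_seeds_hdivcapcup_ofConnectedTemperoidData`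
at the genuine data) from print's own inputs of that sentence:
* `A_1` Frobenius-trivial (a FIELD of the root datum at the genuine data: `NthRoot.αData.isFrobeniusTrivial` — discharged there);
* "`Ψ` preserves Frobenius-trivial objects" ([FrdI] Thm. 3.4 / Cor. 4.11 (ii), binder `hΨFT`);
* "`A_1^bs` is characteristic": `Ψ(A_1)^bs ≅ A_1^bs` (binder `hbs`, Prop. 2.4 class);
* [FrdI] Thm. 5.1 (iii) and Def. 1.3 (iii)(d) — THEOREMS of layer L1 at the model (abc-iut-L2-d4's `iso_of_baseIso_of_model`,
  `exists_iso_of_div_eq`);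
* and ONE `β`-free divisor-transport binder `hdivA : ∀ α : Ψ(A_1) ⥲ A_1, ∃ ε ∈ Aut_C(A_1)` matching the zero divisors of BOTH
  transported sections `α⁻¹ ≫ Ψ(s^⊓_1)`, `α⁻¹ ≫ Ψ(s^⊔_1)` with those of `ε ≫ s^⊓_1`, `ε ≫ s^⊔_1` in `Φ(A_1)` — "Prop. 5.3 (vi) read at
  `A_1`" in the `β`-free currency of abc-iut-L2-d4's Thm. 5.10 (i) file (`preservesIsoClasses_of`, there for `s^⊓` alone).
So the capstone's residual {seeds, `hdivcap₁`, `hdivcup₁`} becomes {`hΨFT`, `hbs`, `hdivA`}: `βs` is never an input (it is the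
[FrdI] Def. 1.3 (iii)(d) codomain isomorphism), and the `e = 1` normalisation is the re-seeding `αs := α ≪≫ ε`.
HONEST FRAMING: kernel-checked implications between typed statements about the §5 data; nothing here asserts a result of [EtTh]
for an actual curve; typed ≠ discharged; no side is taken on [IUTchIII] Cor. 3.12.
-/

namespace Literature.AnabelianGeometry.EtaleTheta

open CategoryTheory Opposite Literature.AlgebraicGeometry.Frobenioids

universe w v u

namespace ThetaFrobenioid

variable {D : Type u} [Category.{v} D] {Φ B : Dᵒᵖ ⥤ CommMonCat.{w}} {DivB : B ⟶ monoidGp Φ}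
  {𝔉 : ThetaFrobenioid.{w} (ModelFrobenioid Φ B DivB) D}

section Model

variable (Ψ : ModelFrobenioid Φ B DivB ≌ ModelFrobenioid Φ B DivB)

/-- Re-seeding along `ε ∈ Aut_C(A_N)` in the `β`-free currency (model case): if `Div(α⁻¹ ≫ Ψ(s)) = Div(ε ≫ s)` then
`Div((α ≪≫ ε)⁻¹ ≫ Ψ(s)) = Div(s)` ([FrdI] Thm. 5.2 (ii): `Div(ε⁻¹ ≫ t) = Base(ε⁻¹)^* Div(t)`, `Div(ε ≫ s) = Base(ε)^* Div(s)`).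
[cite: MochizukiEtTh2009, Thm 5.6 proof p.329 (PDF p.103)] -/
theorem div_reseed_eq_model (h𝔉 : 𝔉.pre = PreFrobenioidData.ofModel Φ B DivB)
    (hΦd : Objectwise (fun M _ => IsDivisorial M) Φ) {Z : ModelFrobenioid Φ B DivB}
    {α : Ψ.functor.obj 𝔉.AN ≅ 𝔉.AN} {ε : Aut 𝔉.AN} {t : Ψ.functor.obj 𝔉.AN ⟶ Z} {s : 𝔉.AN ⟶ 𝔉.BN}
    (hdiv : 𝔉.pre.div (α.inv ≫ t) = 𝔉.pre.div (ε.hom ≫ s)) :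
    𝔉.pre.div ((α ≪≫ ε).inv ≫ t) = 𝔉.pre.div s := by
  rw [h𝔉, PreFrobenioidData.ofModel_div, PreFrobenioidData.ofModel_div] at hdiv
  rw [h𝔉, PreFrobenioidData.ofModel_div, PreFrobenioidData.ofModel_div, Iso.trans_inv, Category.assoc,
    ModelFrobenioid.div_comp_of_isIso' hΦd ε.inv, hdiv, ModelFrobenioid.div_comp_of_isIso' hΦd ε.hom,
    ← Literature.AlgebraicGeometry.Frobenioids.pull_comp, ← ModelFrobenioid.baseMap_comp, ε.inv_hom_id,
    ModelFrobenioid.baseMap_id, Literature.AlgebraicGeometry.Frobenioids.pull_id]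

/-- **The seeds and the `e = 1` divisor binders, PRODUCED** (model case, base of FSM-type): from `A_N` Frobenius-trivial,
"`Ψ` preserves Frobenius-trivial objects", `Ψ(A_N)^bs ≅ A_N^bs` ("characteristic") and the `β`-free divisor transport
`hdivA` (Prop. 5.3 (vi) read at `A_N`: for every identification `α` some `ε ∈ Aut_C(A_N)` matches the zero divisors of BOTH
transported sections) there are `αs : Ψ(A_N) ⥲ A_N`, `βs : Ψ(B_N) ⥲ B_N` with `Div(αs⁻¹ ≫ Ψ(s^⊓_N) ≫ βs) = Div(s^⊓_N)` and
`Div(αs⁻¹ ≫ Ψ(s^⊔_N) ≫ βs) = Div(s^⊔_N)` — in fact `αs⁻¹ ≫ Ψ(s^⊓_N) ≫ βs = s^⊓_N` on the nose.  [FrdI] Thm. 5.1 (iii) and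
Def. 1.3 (iii)(d) enter as layer-L1 THEOREMS (`iso_of_baseIso_of_model`, `exists_iso_of_div_eq`).
[cite: MochizukiEtTh2009, Thm 5.6 proof p.329 (PDF p.103); Thm 5.10 (i) p.333 (PDF p.107)] -/
theorem exists_seeds_div_eq_refl_model (h𝔉 : 𝔉.pre = PreFrobenioidData.ofModel Φ B DivB)
    (h : ModelFrobenioid.Hypotheses Φ B) (hD : IsOfFSMType D)
    (hFT : 𝔉.IsFrobeniusTrivial 𝔉.AN)
    (hΨFT : PreFrobenioidData.PreservesObj Ψ.functor 𝔉.pre.IsFrobeniusTrivial 𝔉.pre.IsFrobeniusTrivial)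
    (hbs : 𝔉.pre.BaseIsomorphic (Ψ.functor.obj 𝔉.AN) 𝔉.AN)
    (hdivA : ∀ α : Ψ.functor.obj 𝔉.AN ≅ 𝔉.AN, ∃ ε : Aut 𝔉.AN,
      𝔉.pre.div (α.inv ≫ Ψ.functor.map 𝔉.sCap) = 𝔉.pre.div (ε.hom ≫ 𝔉.sCap) ∧
      𝔉.pre.div (α.inv ≫ Ψ.functor.map 𝔉.sCup) = 𝔉.pre.div (ε.hom ≫ 𝔉.sCup)) :
    ∃ (αs : Ψ.functor.obj 𝔉.AN ≅ 𝔉.AN) (βs : Ψ.functor.obj 𝔉.BN ≅ 𝔉.BN),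
      αs.inv ≫ Ψ.functor.map 𝔉.sCap ≫ βs.hom = 𝔉.sCap ∧
      𝔉.pre.div (αs.inv ≫ Ψ.functor.map 𝔉.sCap ≫ βs.hom) = 𝔉.pre.div 𝔉.sCap ∧
      𝔉.pre.div (αs.inv ≫ Ψ.functor.map 𝔉.sCup ≫ βs.hom) = 𝔉.pre.div 𝔉.sCup := by
  -- a first identification from [FrdI] Thm. 5.1 (iii) ("Frobenius-trivial + isomorphic bases ⇒ isomorphic")
  obtain ⟨α⟩ := iso_of_baseIso_of_model h𝔉 h _ _ (hΨFT hFT) hFT hbs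
  -- Prop. 5.3 (vi) read at `A_N`: re-seed along `ε`
  obtain ⟨ε, hcap, hcup⟩ := hdivA α
  have hcap' : 𝔉.pre.div ((α ≪≫ ε).inv ≫ Ψ.functor.map 𝔉.sCap) = 𝔉.pre.div 𝔉.sCap :=
    div_reseed_eq_model Ψ h𝔉 h.isDivisorial hcap
  have hcup' : 𝔉.pre.div ((α ≪≫ ε).inv ≫ Ψ.functor.map 𝔉.sCup) = 𝔉.pre.div 𝔉.sCup :=
    div_reseed_eq_model Ψ h𝔉 h.isDivisorial hcup
  -- [FrdI] Def. 1.3 (iii)(d): pre-steps out of `A_N` with the same zero divisor have isomorphic codomains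
  obtain ⟨βs, hβs⟩ := exists_iso_of_div_eq (epi_of_model h) (isOfIsotropicType_of_model h𝔉 h.isGroupLike_rat)
    (iiid_of_model h𝔉 h.isGroupLike_rat)
    (isPreStep_iso_hom_comp (α ≪≫ ε).symm (preservesPreSteps_of_model h𝔉 h hD Ψ 𝔉.sCap 𝔉.isPreStep_sCap))
    𝔉.isPreStep_sCap hcap'
  have hβs' : (α ≪≫ ε).inv ≫ Ψ.functor.map 𝔉.sCap ≫ βs.hom = 𝔉.sCap := by
    rw [← Category.assoc]; exact hβs
  refine ⟨α ≪≫ ε, βs, hβs', ?_, ?_⟩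
  · rw [hβs']
  · rw [h𝔉, PreFrobenioidData.ofModel_div, PreFrobenioidData.ofModel_div] at hcup'
    rw [h𝔉, PreFrobenioidData.ofModel_div, PreFrobenioidData.ofModel_div, ← Category.assoc,
      ModelFrobenioid.div_comp_of_isIso h.isDivisorial, hcup']

end Model

/-! ### At the genuine §5 data `ofConnectedTemperoidData` (the anchor level of abc-iut-L2-d4's capstone) -/

section ConnectedTemperoidData

open Literature.AnabelianGeometry.SemiGraphs Literature.AnabelianGeometry.SemiGraphs.GaloisObjects FrobenioidCyclotomicRigidity

universe u₀ v₀ w₀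

variable {K : Type u₀} [Field K] {X : SemiGraphs.TemperedArithmeticGroup.{u₀} K} {D₀ : Type u₀} [Category.{v₀} D₀]
  {V : FrdIMonoidStub.{w₀}} {T₀ : RealifiedDivisorMonoids (D₀ := D₀) V}
  {VD : FrdICatStub.{u₀ + 1, u₀, w₀} (ConnectedPart (BTemp X.Pi))}
  {tf : TemperedFrobenioid T₀ (ConnectedPart (BTemp X.Pi)) VD} {hZ : tf.monoidType = MonoidType.Z}
  {hP : ∀ A : (ConnectedPart (BTemp X.Pi))ᵒᵖ, IsPerfect (tf.Φ.carrier A)}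
  {NH : Subgroup (Field.absoluteGaloisGroup K) → tf.category → ℕ+ → Prop} {A₀ : tf.category}
  {hA₀ : PreFrobenioid.IsFrobeniusTrivial tf.toElem A₀} {hA₀' : SemiGraphs.IsGaloisObj A₀.base.obj}
  {lv N : ℕ+} {T : ThetaEnvData.{max u₀ w₀} N}
  {pullFrac : ∀ {A A' : (BiKummerSetting.mkOfConnectedTemperoid X tf hZ hP NH A₀ hA₀ hA₀').C} (_ : A' ⟶ A),
    (BiKummerSetting.mkOfConnectedTemperoid X tf hZ hP NH A₀ hA₀ hA₀').biratUnits A →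
      (BiKummerSetting.mkOfConnectedTemperoid X tf hZ hP NH A₀ hA₀ hA₀').biratUnits A'}
  {θ : (BiKummerSetting.mkOfConnectedTemperoid X tf hZ hP NH A₀ hA₀ hA₀').biratUnits
    (BiKummerSetting.mkOfConnectedTemperoid X tf hZ hP NH A₀ hA₀ hA₀').Aodot}
  {Bl : (BiKummerSetting.mkOfConnectedTemperoid X tf hZ hP NH A₀ hA₀ hA₀').C}
  {Pl : (BiKummerSetting.mkOfConnectedTemperoid X tf hZ hP NH A₀ hA₀ hA₀').FractionPair θ Bl}
  {Rl : (BiKummerSetting.mkOfConnectedTemperoid X tf hZ hP NH A₀ hA₀ hA₀').NthRoot θ Pl lv pullFrac}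
  (h : ModelFrobenioid.Hypotheses tf.divisorMonoid tf.ratFnFunctor)
  (Q : FrobenioidTheta.ThetaSubquotientStub.{w₀} (ConnectedPart (BTemp X.Pi))) (odd_l : Odd (lv : ℕ))
  (R : (BiKummerSetting.mkOfConnectedTemperoid X tf hZ hP NH A₀ hA₀ hA₀').NthRoot Rl.root Rl.pair N pullFrac)
  (ιX : T.PiX ≃ₜ* X.Pi) (K' : Type w₀) [Field K'] (constEmb : K'ˣ →* tf.biratUnitsModel R.BN)
  (constEmb_injective : Function.Injective constEmb)
  (hinvc : ∀ g : Aut R.AN.base,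
    pull tf.divisorMonoid g.hom (ModelFrobenioid.div R.pair.num) = ModelFrobenioid.div R.pair.num)
  (hinvp : ∀ y : T.PiX, y ∈ T.PiYdd →
    pull tf.divisorMonoid ((BiKummerSetting.mkOfConnectedTemperoid X tf hZ hP NH A₀ hA₀ hA₀').galoisSurj R.AN.base
      R.αData.isGalois (ιX y)).hom (ModelFrobenioid.div R.pair.den) = ModelFrobenioid.div R.pair.den)
  (Ψ : (BiKummerSetting.mkOfConnectedTemperoid X tf hZ hP NH A₀ hA₀ hA₀').C ≌
    (BiKummerSetting.mkOfConnectedTemperoid X tf hZ hP NH A₀ hA₀ hA₀').C)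

/-- **The seeds `αs, βs` and `hdivcap₁`/`hdivcup₁` of abc-iut-L2-d4's anchored capstone, PRODUCED at the genuine data**
`𝔉 := ofConnectedTemperoidData …` (`A_N := R.AN` IS Frobenius-trivial: the field `NthRoot.αData.isFrobeniusTrivial`; the base
`B^temp(Π^tp_X)⁰` is of FSM-type, [FrdII] Ex. 1.3): from "`Ψ` preserves Frobenius-trivial objects" (`hΨFT`), `Ψ(A_N)^bs ≅ A_N^bs`
(`hbs`) and the `β`-free divisor transport `hdivA` (Prop. 5.3 (vi) read at `A_N`).
[cite: MochizukiEtTh2009, Thm 5.6 proof p.329 (PDF p.103); Thm 5.10 (i) p.333 (PDF p.107)] -/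
theorem exists_seeds_hdivcapcup_ofConnectedTemperoidData
    (hΨFT : PreFrobenioidData.PreservesObj Ψ.functor
      (ofConnectedTemperoidData h Q odd_l R ιX K' constEmb constEmb_injective hinvc hinvp).pre.IsFrobeniusTrivial
      (ofConnectedTemperoidData h Q odd_l R ιX K' constEmb constEmb_injective hinvc hinvp).pre.IsFrobeniusTrivial)
    (hbs : (ofConnectedTemperoidData h Q odd_l R ιX K' constEmb constEmb_injective hinvc hinvp).pre.BaseIsomorphic
      (Ψ.functor.obj (ofConnectedTemperoidData h Q odd_l R ιX K' constEmb constEmb_injective hinvc hinvp).AN)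
      (ofConnectedTemperoidData h Q odd_l R ιX K' constEmb constEmb_injective hinvc hinvp).AN)
    (hdivA : ∀ α : Ψ.functor.obj (ofConnectedTemperoidData h Q odd_l R ιX K' constEmb constEmb_injective hinvc hinvp).AN ≅
        (ofConnectedTemperoidData h Q odd_l R ιX K' constEmb constEmb_injective hinvc hinvp).AN,
      ∃ ε : Aut (ofConnectedTemperoidData h Q odd_l R ιX K' constEmb constEmb_injective hinvc hinvp).AN,
        (ofConnectedTemperoidData h Q odd_l R ιX K' constEmb constEmb_injective hinvc hinvp).pre.div
            (α.inv ≫ Ψ.functor.map (ofConnectedTemperoidData h Q odd_l R ιX K' constEmb constEmb_injective hinvc hinvp).sCap) =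
          (ofConnectedTemperoidData h Q odd_l R ιX K' constEmb constEmb_injective hinvc hinvp).pre.div
            (ε.hom ≫ (ofConnectedTemperoidData h Q odd_l R ιX K' constEmb constEmb_injective hinvc hinvp).sCap) ∧
        (ofConnectedTemperoidData h Q odd_l R ιX K' constEmb constEmb_injective hinvc hinvp).pre.div
            (α.inv ≫ Ψ.functor.map (ofConnectedTemperoidData h Q odd_l R ιX K' constEmb constEmb_injective hinvc hinvp).sCup) =
          (ofConnectedTemperoidData h Q odd_l R ιX K' constEmb constEmb_injective hinvc hinvp).pre.div
            (ε.hom ≫ (ofConnectedTemperoidData h Q odd_l R ιX K' constEmb constEmb_injective hinvc hinvp).sCup)) :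
    ∃ (αs : Ψ.functor.obj (ofConnectedTemperoidData h Q odd_l R ιX K' constEmb constEmb_injective hinvc hinvp).AN ≅
        (ofConnectedTemperoidData h Q odd_l R ιX K' constEmb constEmb_injective hinvc hinvp).AN)
      (βs : Ψ.functor.obj (ofConnectedTemperoidData h Q odd_l R ιX K' constEmb constEmb_injective hinvc hinvp).BN ≅
        (ofConnectedTemperoidData h Q odd_l R ιX K' constEmb constEmb_injective hinvc hinvp).BN),
      αs.inv ≫ Ψ.functor.map (ofConnectedTemperoidData h Q odd_l R ιX K' constEmb constEmb_injective hinvc hinvp).sCap ≫ βs.hom =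
        (ofConnectedTemperoidData h Q odd_l R ιX K' constEmb constEmb_injective hinvc hinvp).sCap ∧
      (ofConnectedTemperoidData h Q odd_l R ιX K' constEmb constEmb_injective hinvc hinvp).pre.div
          (αs.inv ≫ Ψ.functor.map (ofConnectedTemperoidData h Q odd_l R ιX K' constEmb constEmb_injective hinvc hinvp).sCap ≫
            βs.hom) =
        (ofConnectedTemperoidData h Q odd_l R ιX K' constEmb constEmb_injective hinvc hinvp).pre.div
          (ofConnectedTemperoidData h Q odd_l R ιX K' constEmb constEmb_injective hinvc hinvp).sCap ∧
      (ofConnectedTemperoidData h Q odd_l R ιX K' constEmb constEmb_injective hinvc hinvp).pre.div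
          (αs.inv ≫ Ψ.functor.map (ofConnectedTemperoidData h Q odd_l R ιX K' constEmb constEmb_injective hinvc hinvp).sCup ≫
            βs.hom) =
        (ofConnectedTemperoidData h Q odd_l R ιX K' constEmb constEmb_injective hinvc hinvp).pre.div
          (ofConnectedTemperoidData h Q odd_l R ιX K' constEmb constEmb_injective hinvc hinvp).sCup :=
  exists_seeds_div_eq_refl_model Ψ rfl h QuasiTemperoid.BTempConnected.connectedPart_isOfFSMType
    ((PreFrobenioidData.ofFunctor_isFrobeniusTrivial _ _).mpr R.αData.isFrobeniusTrivial) hΨFT hbs hdivA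

end ConnectedTemperoidData

end ThetaFrobenioid

end Literature.AnabelianGeometry.EtaleTheta
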